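import Literature.NumberTheory.DiophantineGeometry.FibreConductorSummation
import HarnessLib

/-!
# The conductor slope of [GenEll] Thm 2.1's auxiliary fibre: `κ ≤ ((m(e+3) − (3e+3))/e)·h(x) + O(1)`

Assembly lemma for the abc-iut cell's route item GenEllTwo (ledger `stmt-ABC-19679`; [GenEll] =
S. Mochizuki, *Arithmetic elliptic curves in general position*, Math. J. Okayama Univ. **52** (2010),
Thm. 2.1, proof pp. 12–13 — the "sharp Prop. 1.6" step for the reduced fibre of the auxiliary Belyi-type
map; cell work package W5, piece W5d, the hypothesis `hκ` of
`Literature.NumberTheory.DiophantineGeometry.GenEll.vojtaIneq_of_belyi_mechanism`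
(`GenEllPhiMechanism.lean`): `κ P ≤ Bc · P.ht + c₂` with `Bc = (m(e+3) − 3e − 3)/e`, `m = deg β + 2`).

This file is PURE BOOKKEEPING over a number field `L` (`n := [L:ℚ]`): it turns the outputs of the W5
package — stated here as hypotheses in exactly the shapes their files produce — into the slope bound.
Inputs (all about elements `x t N : L`, a finite set `B ⊆ L` of size `m`, a finite set `W` of finite
places "where `t` meets `B`", and a finite set `Sbad` of bad places):

* (placewise, good places — `GenEllDeGoodPrimes(Ord)`, W5 (C) + W5c) for `w ∉ Sbad`:
  `w ∈ W → 1 + ord⁺_w N ≤ Σ_{b∈B} ord⁺_w(t − b)` and `w ∉ W → ord⁺_w N ≤ Σ_{b∈B} ord⁺_w(t − b)`;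
* (bad places — `FibreConductorBadPlaces` from `p`-adic separation, or the R-b defect):
  `Σ_{w∈Sbad} ord⁺_w N·log N(w) ≤ n·C₁` and `Σ_{w∈Sbad} log N(w) ≤ n·C₂`;
* (archimedean separation — `GenEllDeRamificationArch`, W5b): `log⁺|N⁻¹|_v ≤ C₃` at every infinite place;
* (heights — `SuperellipticHeightsT`, W4a): `e·h_L(t) ≤ (e+3)·h_L(x) + n·C₄`,
  `(3e+3)·h_L(x) ≤ e·h_L(N) + n·C₅`, and `h_L(b) ≤ n·C₆` for `b ∈ B` (fixed algebraic numbers).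

Output (`inv_finrank_mul_sum_logNorm_le_slope`):
`(1/n)·Σ_{w∈W} log N(w) ≤ ((m(e+3) − (3e+3))/e)·(h_L(x)/n) + (m·C₄ + C₅)/e + m·(C₆ + log 2) + C₁ + C₂ + C₃`.
The slope is Riemann–Hurwitz for the degree-`(e+3)` function `t` on the genus-`(e−1)/2` curve:
`|t⁻¹(B)| = m(e+3) − (2g − 2 + 2(e+3)) = m(e+3) − (3e+3)` (`GENELLTWO-P1ROUTE.md` §3 (d)–(e)).
No definitions; classical; nothing here refers to the disputed parts of the abc-iut corpus.
[cite: MochizukiGenEll2010, Thm 2.1 proof pp.12-13] [cite: BombieriGubler2006, §1.5]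
-/

noncomputable section

open NumberField IsDedekindDomain Height Real Finset
open Literature.IUT.LogVolume

namespace Literature.NumberTheory.DiophantineGeometry.FibreConductor

variable {L : Type*} [Field L] [NumberField L]

/-- Heights of the differences `t − b`: `Σ_{b∈B} h_L(t − b) ≤ m·h_L(t) + Σ_{b∈B} h_L(b) + m·n·log 2`
(Mathlib `logHeight₁_sub_le`). [cite: BombieriGubler2006, §1.5] -/
theorem sum_logHeight₁_sub_le (t : L) (B : Finset L) :
    ∑ b ∈ B, logHeight₁ (t - b) ≤
      B.card * logHeight₁ t + ∑ b ∈ B, logHeight₁ b + B.card * (totalWeight L * Real.log 2) := by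
  have h : ∀ b ∈ B, logHeight₁ (t - b) ≤ logHeight₁ t + logHeight₁ b + totalWeight L * Real.log 2 := by
    intro b _
    have := logHeight₁_sub_le t b
    linarith
  calc ∑ b ∈ B, logHeight₁ (t - b)
      ≤ ∑ b ∈ B, (logHeight₁ t + logHeight₁ b + totalWeight L * Real.log 2) := Finset.sum_le_sum h
    _ = B.card * logHeight₁ t + ∑ b ∈ B, logHeight₁ b + B.card * (totalWeight L * Real.log 2) := by
        rw [Finset.sum_add_distrib, Finset.sum_add_distrib, Finset.sum_const, Finset.sum_const,
          nsmul_eq_mul, nsmul_eq_mul]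

/-- **The conductor slope (unnormalised form).**  With the inputs described in the module docstring,
`Σ_{w∈W} log N(w) ≤ ((m(e+3) − (3e+3))/e)·h_L(x) + n·((m·C₄ + C₅)/e + m·(C₆ + log 2) + C₁ + C₂ + C₃)`
where `h_L = logHeight₁`, `n = [L:ℚ]`, `m = |B|`, `e = 2k+1`.
[cite: MochizukiGenEll2010, Thm 2.1 proof pp.12-13] -/
theorem sum_logNorm_le_slope (k : ℕ) (x t N : L) (B : Finset L)
    (W Sbad : Finset (HeightOneSpectrum (𝓞 L))) {C₁ C₂ C₃ C₄ C₅ C₆ : ℝ}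
    (hmeet : ∀ w ∈ W, w ∉ Sbad → 1 + (ord L w N).toNat ≤ ∑ b ∈ B, (ord L w (t - b)).toNat)
    (hoff : ∀ w, w ∉ W → w ∉ Sbad → (ord L w N).toNat ≤ ∑ b ∈ B, (ord L w (t - b)).toNat)
    (hbad₁ : ∑ w ∈ Sbad, ((ord L w N).toNat : ℝ) * logNorm L w ≤ Module.finrank ℚ L * C₁)
    (hbad₂ : ∑ w ∈ Sbad, logNorm L w ≤ Module.finrank ℚ L * C₂)
    (harch : ∀ v : InfinitePlace L, log⁺ (v N⁻¹) ≤ C₃)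
    (ht : (2 * k + 1 : ℝ) * logHeight₁ t ≤ (2 * k + 4 : ℝ) * logHeight₁ x + Module.finrank ℚ L * C₄)
    (hN : (6 * k + 6 : ℝ) * logHeight₁ x ≤ (2 * k + 1 : ℝ) * logHeight₁ N + Module.finrank ℚ L * C₅)
    (hB : ∀ b ∈ B, logHeight₁ b ≤ Module.finrank ℚ L * C₆) :
    ∑ w ∈ W, logNorm L w ≤
      ((B.card * (2 * k + 4 : ℝ) - (6 * k + 6)) / (2 * k + 1)) * logHeight₁ x +
        Module.finrank ℚ L * ((B.card * C₄ + C₅) / (2 * k + 1) + B.card * (C₆ + Real.log 2) +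
          C₁ + C₂ + C₃) := by
  set n : ℝ := (Module.finrank ℚ L : ℝ) with hn
  have hnpos : 0 < n := by rw [hn]; exact_mod_cast Module.finrank_pos
  have he : (0 : ℝ) < 2 * k + 1 := by positivity
  -- the summation over all places, good/bad form, with `τ b := t − b` indexed by the subtype of `B`
  have hA : ∑ v : InfinitePlace L, (v.mult : ℝ) * log⁺ (v N⁻¹) ≤ n * C₃ := by
    rw [hn]; exact sum_mult_mul_posLog_inv_le_of_forall N harch
  have key := sum_logNorm_le_of_good_bad (ι := B) N (fun b : B => t - (b : L)) W Sbad
    (A := n * C₃) (C := n * C₁)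
    (fun w hw hb => by rw [Finset.sum_coe_sort B (fun b => (ord L w (t - b)).toNat)]; exact hmeet w hw hb)
    (fun w hw hb => by rw [Finset.sum_coe_sort B (fun b => (ord L w (t - b)).toNat)]; exact hoff w hw hb)
    (by rw [hn]; exact hbad₁) hA
  rw [Finset.sum_coe_sort B (fun b => logHeight₁ (t - b))] at key
  -- heights of the differences
  have hdiff := sum_logHeight₁_sub_le t B
  rw [NumberField.totalWeight_eq_finrank] at hdiff
  have hBsum : ∑ b ∈ B, logHeight₁ b ≤ B.card * (n * C₆) := by
    calc ∑ b ∈ B, logHeight₁ b ≤ ∑ b ∈ B, n * C₆ := Finset.sum_le_sum fun b hb => by rw [hn]; exact hB b hb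
      _ = B.card * (n * C₆) := by rw [Finset.sum_const, nsmul_eq_mul]
  -- `m · h(t)` via `ht`, and `−h(N)` via `hN` (divide by `e = 2k+1`)
  have hm0 : (0 : ℝ) ≤ B.card := Nat.cast_nonneg _
  have ht' : logHeight₁ t ≤ ((2 * k + 4 : ℝ) * logHeight₁ x + n * C₄) / (2 * k + 1) := by
    rw [le_div_iff₀ he]; rw [hn]; linarith
  have hN' : -logHeight₁ N ≤ (-(6 * k + 6 : ℝ) * logHeight₁ x + n * C₅) / (2 * k + 1) := by
    rw [le_div_iff₀ he]; rw [hn]; linarith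
  have hmt : (B.card : ℝ) * logHeight₁ t ≤
      B.card * (((2 * k + 4 : ℝ) * logHeight₁ x + n * C₄) / (2 * k + 1)) :=
    mul_le_mul_of_nonneg_left ht' hm0
  have hbad₂' : ∑ w ∈ Sbad, logNorm L w ≤ n * C₂ := by rw [hn]; exact hbad₂
  have hdiff' : ∑ b ∈ B, logHeight₁ (t - b) ≤
      B.card * logHeight₁ t + ∑ b ∈ B, logHeight₁ b + B.card * (n * Real.log 2) := by
    rw [hn]; exact hdiff
  -- assemble
  have htotal : ∑ w ∈ W, logNorm L w ≤
      B.card * (((2 * k + 4 : ℝ) * logHeight₁ x + n * C₄) / (2 * k + 1)) + B.card * (n * C₆) +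
        B.card * (n * Real.log 2) + (-(6 * k + 6 : ℝ) * logHeight₁ x + n * C₅) / (2 * k + 1) +
        n * C₃ + (n * C₁ + n * C₂) := by
    linarith
  have halg : B.card * (((2 * k + 4 : ℝ) * logHeight₁ x + n * C₄) / (2 * k + 1)) + B.card * (n * C₆) +
        B.card * (n * Real.log 2) + (-(6 * k + 6 : ℝ) * logHeight₁ x + n * C₅) / (2 * k + 1) +
        n * C₃ + (n * C₁ + n * C₂) =
      ((B.card * (2 * k + 4 : ℝ) - (6 * k + 6)) / (2 * k + 1)) * logHeight₁ x +
        n * ((B.card * C₄ + C₅) / (2 * k + 1) + B.card * (C₆ + Real.log 2) + C₁ + C₂ + C₃) := by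
    field_simp
    ring
  rw [hn] at halg
  rw [hn] at htotal
  linarith [htotal, halg.le, halg.ge]

/-- **The conductor slope, normalised (`hκ` shape).**  Dividing by `n = [L:ℚ]`:
`(1/n)·Σ_{w∈W} log N(w) ≤ ((m(e+3) − (3e+3))/e)·(h_L(x)/n) + ((m·C₄ + C₅)/e + m·(C₆ + log 2) + C₁ + C₂ + C₃)`;
with `m = deg β + 2` the slope is `Bc` of `GenEll.slope_sub_eq` and the constant is the `c₂` of
`vojtaIneq_of_belyi_mechanism`. [cite: MochizukiGenEll2010, Thm 2.1 proof pp.12-13] -/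
theorem inv_finrank_mul_sum_logNorm_le_slope (k : ℕ) (x t N : L) (B : Finset L)
    (W Sbad : Finset (HeightOneSpectrum (𝓞 L))) {C₁ C₂ C₃ C₄ C₅ C₆ : ℝ}
    (hmeet : ∀ w ∈ W, w ∉ Sbad → 1 + (ord L w N).toNat ≤ ∑ b ∈ B, (ord L w (t - b)).toNat)
    (hoff : ∀ w, w ∉ W → w ∉ Sbad → (ord L w N).toNat ≤ ∑ b ∈ B, (ord L w (t - b)).toNat)
    (hbad₁ : ∑ w ∈ Sbad, ((ord L w N).toNat : ℝ) * logNorm L w ≤ Module.finrank ℚ L * C₁)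
    (hbad₂ : ∑ w ∈ Sbad, logNorm L w ≤ Module.finrank ℚ L * C₂)
    (harch : ∀ v : InfinitePlace L, log⁺ (v N⁻¹) ≤ C₃)
    (ht : (2 * k + 1 : ℝ) * logHeight₁ t ≤ (2 * k + 4 : ℝ) * logHeight₁ x + Module.finrank ℚ L * C₄)
    (hN : (6 * k + 6 : ℝ) * logHeight₁ x ≤ (2 * k + 1 : ℝ) * logHeight₁ N + Module.finrank ℚ L * C₅)
    (hB : ∀ b ∈ B, logHeight₁ b ≤ Module.finrank ℚ L * C₆) :
    (Module.finrank ℚ L : ℝ)⁻¹ * ∑ w ∈ W, logNorm L w ≤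
      ((B.card * (2 * k + 4 : ℝ) - (6 * k + 6)) / (2 * k + 1)) *
          ((Module.finrank ℚ L : ℝ)⁻¹ * logHeight₁ x) +
        ((B.card * C₄ + C₅) / (2 * k + 1) + B.card * (C₆ + Real.log 2) + C₁ + C₂ + C₃) := by
  set n : ℝ := (Module.finrank ℚ L : ℝ) with hn
  have hnpos : 0 < n := by rw [hn]; exact_mod_cast Module.finrank_pos
  have h := sum_logNorm_le_slope k x t N B W Sbad hmeet hoff hbad₁ hbad₂ harch ht hN hB
  rw [← hn] at h
  have h' := mul_le_mul_of_nonneg_left h (inv_nonneg.mpr hnpos.le)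
  have hc : n⁻¹ * (n * ((B.card * C₄ + C₅) / (2 * k + 1) + B.card * (C₆ + Real.log 2) + C₁ + C₂ + C₃)) =
      (B.card * C₄ + C₅) / (2 * k + 1) + B.card * (C₆ + Real.log 2) + C₁ + C₂ + C₃ := by
    rw [← mul_assoc, inv_mul_cancel₀ hnpos.ne', one_mul]
  have e1 : n⁻¹ * (((B.card * (2 * k + 4 : ℝ) - (6 * k + 6)) / (2 * k + 1)) * logHeight₁ x) =
      ((B.card * (2 * k + 4 : ℝ) - (6 * k + 6)) / (2 * k + 1)) * (n⁻¹ * logHeight₁ x) := by ring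
  rw [mul_add, hc, e1] at h'
  exact h'

end Literature.NumberTheory.DiophantineGeometry.FibreConductor
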